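import Mathlib
import HarnessLib
import Summits.HubbardSuperconductivity.HubbardSuperconductivity.Theorems.KLProgrammeKLRegimeEngineTowerBookkeepingSplit
import Summits.HubbardSuperconductivity.HubbardSuperconductivity.Theorems.KLProgrammeKLRegimeEngineTowerSplitCountRate

/-!
# Route `KLProgramme` — crux K3 ENGINE (stmt-HubbardSuperconductivity-20437 `KLRegimeEngineV17F2`), stub (b) v2, THE LEVELS PACKAGE (ℓ):
# the blocked-tower bookkeeping, part 9′ — the induction over blocks for FINITELY MANY COUPLED TRACKS at track-dependent rates (T-L core)
# (cell gate-hubbard-kl, seat gate-hubbard-kl-p4 g13; E1-TOWER-BLOCKED §10(b) «(T3-L) = T3₄ per track»; memos HOME/prover-p4/LEV-UNITS-NOTE.md, TWO-ANCHOR-FALSE.md)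

Part 9 (`…EngineTowerBookkeepingSplit`, `towerBorn_le_law_split`) closes the blocked birth-level recursion for TWO coupled tracks — `b` (one leg pinned) and
`b₂` (all labels known) — at the one-leg-pinned rates `g^{(m−2)·jump}` / `g^{(m−3)·jump}·h^{k′}`.  The levels package (ℓ) carries born sizes PER TRACK
`t` (= number of known external legs, in the track's own units `2^{(3p−5)J}·2^{−e(t)J}`), every track obeying the SAME law `A λ^{p−1} Q^p`; the tracks are
coupled only through (i) the re-measurement rows — off the umklapp class on the track's own born sizes at the track's rate `r_t^{(a_t·m − b_t)·jump}`, on the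
class on the TOP (all-known) track's born sizes at rate `r_t^{(a_t·m − b′_t)·jump}·h_t^{k′}` (part 8′ `towerMeasured_le_profile_split_rate`; six legs:
`g₃,t^{jump}` / `h_t^{k′}`, part 9's `towerMeasured_three_le_split`) — and (ii) the block step, which for EVERY output track reads one track-blind array of
measured input sizes `μ k ·` (the supplier's finitely many allowed input-track assignments absorbed into `Φ`; E1-TOWER-BLOCKED §10(b)), itself dominated at
each `(k, m)` by SOME track's two-row sum (e.g. `μ k m := max_t μ_t k m`).  This file is the simultaneous induction:

* **`towerBorn_le_law_tracks`** (T3-L) — tracks `t : T` (`Fintype`), top track `top`, per-track rate data `(r, a, b, b′, h, g₃, c₁, c₂, c₃)_t` with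
  `b_t + 1 ≤ 3a_t`, `b′_t ≤ 3a_t`; UV law for every track; (Hμ) in the dominated form `∃ t, μ k m ≤ two-row_t` (degrees `2m ≥ 8`) and `∃ t, μ k 3 ≤ six-leg
  two-row_t`; imports `μ k 1 ≤ ι₁λ`, `μ k 2 ≤ ι₂λ`; the step hypothesis for EVERY track with the common Chernoff data `μ k ·`; numerics as T3₄/T3₅ with
  `A′ ≥ (c₁,t/((1−r_t)r_t^{b_t}) + c₃,t/((1−h_t)r_t^{b′_t}))·A`, `Q′ ≥ c₂,t r_t^{a_t} Q`, `ι₃ ≥ (c₁,t g₃,t/(1−g₃,t) + c₃,t/(1−h_t))·c₂,t³AQ³` for every `t`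
  ⊢ `∀ k ≤ K, ∀ t, ∀ 3 ≤ p ≤ D, b t k p ≤ A λ^{p−1} Q^p`.
Part 9 is the instance `T = {pinned, top}` at `(r, a, b, b′) = (g, 1, 2, 3)`; the half-integer units `e* = min((F−1)/2, 2)` are the instance `T = {1, 2, 3, 4, top}`
with `(√g, 2, 4, 6)`, `(√g, 2, 5, 5)`, `(√g, 2, 4, 4)`, `(√g, 2, 3, 3)` (the cells of LEV-UNITS-NOTE §2), every rate admissible.
Pure real analysis; nothing about the model is asserted; nothing asserts superconductivity.
References: Benfatto–Giuliani–Mastropietro 2006 §2.8 (2.83), (2.93)–(2.98) [cite: BenfattoGiulianiMastropietro2006]; Gawȩdzki–Kupiainen 1985 §3.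
-/

noncomputable section

namespace Summit.HubbardSuperconductivity.HubbardSuperconductivity.Theorems.EngineV8

set_option linter.dupNamespace false -- summit = problem name (single-conjunct summit), D-0017

open Real Finset

/-- **(T3-L) The blocked birth-level tower with finitely many coupled tracks at track-dependent rates.**  Born sizes `b t k p` per track `t : T`
(each in its own units, all under the law `A λ^{p−1} Q^p`), a top (all-known) track `top`; the common measured array `μ k ·` read by every track's block
step is dominated at each `(k, m)` by some track's split re-measurement sum (off-class on `b t` at rate `r_t^{(a_t m − b_t)·jump}`, on-class on `b top`
at rate `r_t^{(a_t m − b′_t)·jump}·h_t^{k′}`; six legs `g₃,t^{jump}` / `h_t^{k′}`); imports `ι₁λ`, `ι₂λ`; numerics as T3₅ uniformly in `t`.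
Conclusion: every track obeys `A λ^{p−1} Q^p` at every boundary. [cite: BenfattoGiulianiMastropietro2006, §2.8 (2.83), (2.93)-(2.98)] -/
theorem towerBorn_le_law_tracks {T : Type*} (top : T) {D K : ℕ} {b : T → ℕ → ℕ → ℝ} {μ : ℕ → ℕ → ℝ}
    {A lam Q σ Φ ψ τ A' Q' ι₁ ι₂ ι₃ : ℝ} {r h g₃ c₁ c₂ c₃ : T → ℝ} {a bo bon : T → ℕ}
    (hA : 0 ≤ A) (hlam : 0 < lam) (hQ : 0 ≤ Q)
    (hr0 : ∀ t, 0 < r t) (hr1 : ∀ t, r t < 1) (hg₃0 : ∀ t, 0 ≤ g₃ t) (hg₃1 : ∀ t, g₃ t < 1) (hh0 : ∀ t, 0 ≤ h t) (hh1 : ∀ t, h t < 1)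
    (hc₁ : ∀ t, 0 ≤ c₁ t) (hc₂ : ∀ t, 0 ≤ c₂ t) (hc₃ : ∀ t, 0 ≤ c₃ t) (hab : ∀ t, bo t + 1 ≤ 3 * a t) (hab' : ∀ t, bon t ≤ 3 * a t)
    (hσ : 0 ≤ σ) (hΦ : 0 ≤ Φ) (hψ : 0 ≤ ψ) (hτ : 0 < τ) (hQ'0 : 0 < Q') (hA'0 : 0 ≤ A')
    (hA'ge : ∀ t, (c₁ t / ((1 - r t) * r t ^ bo t) + c₃ t / ((1 - h t) * r t ^ bon t)) * A ≤ A')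
    (hQ'ge : ∀ t, c₂ t * r t ^ a t * Q ≤ Q')
    (hι₃ge : ∀ t, (c₁ t * (g₃ t / (1 - g₃ t)) + c₃ t * (1 / (1 - h t))) * c₂ t ^ 3 * A * Q ^ 3 ≤ ι₃)
    (hb0 : ∀ t k m, 0 ≤ b t k m) (hμ0 : ∀ k m, 0 ≤ μ k m)
    (h0 : ∀ t p, 3 ≤ p → p ≤ D → b t 0 p ≤ A * lam ^ (p - 1) * Q ^ p)
    (hμ : ∀ k < K, ∀ m, 4 ≤ m → m ≤ D → ∃ t,
      μ k m ≤ ∑ k' ∈ range (k + 1), c₁ t * c₂ t ^ m * r t ^ ((a t * m - bo t) * (k + 1 - k')) * b t k' m +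
        ∑ k' ∈ range (k + 1), c₃ t * c₂ t ^ m * r t ^ ((a t * m - bon t) * (k + 1 - k')) * h t ^ k' * b top k' m)
    (hμ3 : ∀ k < K, 3 ≤ D → ∃ t, μ k 3 ≤ ∑ k' ∈ range (k + 1), c₁ t * c₂ t ^ 3 * g₃ t ^ (k + 1 - k') * b t k' 3 +
      ∑ k' ∈ range (k + 1), c₃ t * c₂ t ^ 3 * h t ^ k' * b top k' 3)
    (hι₁ : ∀ k < K, μ k 1 ≤ ι₁ * lam) (hι₂ : ∀ k < K, μ k 2 ≤ ι₂ * lam)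
    (hstep : ∀ t, ∀ k < K, ∀ N : ℕ, 2 ≤ N → ∀ p, 3 ≤ p → p ≤ D → Φ * towerV D τ (μ k) < 1 →
      b t (k + 1) p ≤ towerFO D σ (μ k) p + ∑ n ∈ Icc 2 N, exp 1 * Φ ^ (n - 1) * ψ ^ p * towerS D τ (μ k) n p +
        ψ ^ p * exp 1 * towerV D τ (μ k) * (Φ * towerV D τ (μ k)) ^ N / (1 - Φ * towerV D τ (μ k)))
    (hx₁ : 4 * σ * lam * Q' < 1) (hx₂ : 2 * lam * τ * Q' ≤ 1) (hx₃ : exp 1 * τ * lam * Q' < 1)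
    (hy : Φ * (τ * (ι₁ * lam + ι₂ / (2 * Q') + ι₃ / (4 * Q' ^ 2) + A' * Q' / 4)) < 1)
    (hθ : Φ * (exp 1 * τ * (ι₁ * lam) + (exp 1 * τ) ^ 2 * (ι₂ * lam) + (exp 1 * τ) ^ 3 * (ι₃ * lam ^ 2) +
      A' * (exp 1 * τ * Q') * ((exp 1 * τ * lam * Q') ^ 3 / (1 - exp 1 * τ * lam * Q'))) < 1)
    (hu₁ : 4 * Q' ≤ Q) (hu₂ : 2 * τ * ψ * Q' ≤ Q)
    (hclose : A' * (4 * Q') ^ 3 * (4 * σ * lam * Q' / (1 - 4 * σ * lam * Q')) +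
      exp 1 * ψ * (2 * τ * ψ * Q') ^ 2 * (τ * (ι₁ * lam + ι₂ / (2 * Q') + ι₃ / (4 * Q' ^ 2) + A' * Q' / 4)) *
        (Φ * (τ * (ι₁ * lam + ι₂ / (2 * Q') + ι₃ / (4 * Q' ^ 2) + A' * Q' / 4)) /
          (1 - Φ * (τ * (ι₁ * lam + ι₂ / (2 * Q') + ι₃ / (4 * Q' ^ 2) + A' * Q' / 4)))) ≤ A * Q ^ 3) :
    ∀ k ≤ K, ∀ t, ∀ p, 3 ≤ p → p ≤ D → b t k p ≤ A * lam ^ (p - 1) * Q ^ p := by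
  have hx10 : 0 ≤ 4 * σ * lam * Q' / (1 - 4 * σ * lam * Q') := div_nonneg (by positivity) (sub_nonneg.2 hx₁.le)
  have hw : 1 ≤ (2 * τ * Q' * lam)⁻¹ := (one_le_inv₀ (by positivity)).2 (by linarith)
  set Y := ι₁ * lam + ι₂ / (2 * Q') + ι₃ / (4 * Q' ^ 2) + A' * Q' / 4 with hY
  suffices H : ∀ k ≤ K, ∀ k' ≤ k, ∀ t, ∀ p, 3 ≤ p → p ≤ D → b t k' p ≤ A * lam ^ (p - 1) * Q ^ p from
    fun k hk t p hp hpD => H k hk k le_rfl t p hp hpD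
  intro k
  induction k with
  | zero => intro _ k' hk' t p hp hpD; rw [Nat.le_zero.1 hk']; exact h0 t p hp hpD
  | succ k ih =>
    intro hk1 k' hk' t p hp hpD
    have hkK : k < K := Nat.lt_of_succ_le hk1
    have ih' := ih (Nat.le_of_succ_le hk1)
    rcases Nat.lt_succ_iff_lt_or_eq.1 (Nat.lt_succ_of_le hk') with hlt | rfl
    · exact ih' k' (Nat.lt_succ_iff.1 hlt) t p hp hpD
    · have hD3 : 3 ≤ D := hp.trans hpD
      -- degrees ≥ 8: the measured profile from the dominating track's split re-measurement row at its own rate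
      have hprof : ∀ m, 4 ≤ m → m ≤ D → μ k m ≤ A' * lam ^ (m - 1) * Q' ^ m := by
        intro m hm4 hmD
        obtain ⟨t', ht'⟩ := hμ k hkK m hm4 hmD
        set ν : ℕ → ℕ → ℝ := fun k m =>
          ∑ k' ∈ range (k + 1), c₁ t' * c₂ t' ^ m * r t' ^ ((a t' * m - bo t') * (k + 1 - k')) * b t' k' m +
            ∑ k' ∈ range (k + 1), c₃ t' * c₂ t' ^ m * r t' ^ ((a t' * m - bon t') * (k + 1 - k')) * h t' ^ k' * b top k' m with hν
        have hT1 := towerMeasured_le_profile_split_rate (D := D) (μ := ν) hA hlam.le hQ (hr0 t') (hr1 t') (hh0 t') (hh1 t') (hc₁ t') (hc₂ t')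
          (hc₃ t') (hab t') (hab' t') (hb0 t') (hb0 top) (k := k) (fun m _ _ => le_rfl) (fun k' hk' m hm hmD => ih' k' hk' t' m hm hmD)
          (fun k' hk' m hm hmD => ih' k' hk' top m hm hmD) (by omega : 3 ≤ m) hmD
        refine (ht'.trans hT1).trans ?_
        have : 0 ≤ (c₁ t' / ((1 - r t') * r t' ^ bo t') + c₃ t' / ((1 - h t') * r t' ^ bon t')) * A := by
          have := hr1 t'; have := hh1 t'; have := hr0 t'; have := hh0 t'; have := hc₁ t'; have := hc₃ t'
          have h1 : 0 < 1 - r t' := sub_pos.2 (hr1 t')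
          have h2 : 0 < 1 - h t' := sub_pos.2 (hh1 t')
          positivity
        have : 0 ≤ c₂ t' * r t' ^ a t' * Q := by have := hc₂ t'; have := hr0 t'; positivity
        have := hA'ge t'; have := hQ'ge t'
        gcongr
      -- six legs: the import `ι₃ λ²` from the dominating track's two-row six-leg re-measurement
      have hμ3' : μ k 3 ≤ ι₃ * lam ^ 2 := by
        obtain ⟨t', ht'⟩ := hμ3 k hkK hD3
        have h3 := towerMeasured_three_le_split (μ := μ) hA hQ (hg₃0 t') (hg₃1 t') (hh0 t') (hh1 t') (hc₁ t') (hc₂ t') (hc₃ t')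
          (hb0 t') (hb0 top) ht' (fun k' hk' => ih' k' hk' t' 3 le_rfl hD3) (fun k' hk' => ih' k' hk' top 3 le_rfl hD3)
        exact h3.trans (mul_le_mul_of_nonneg_right (hι₃ge t') (sq_nonneg lam))
      -- Chernoff data
      have hG := sum_fourPiece_le (D := D) hτ hlam hQ'0 hA'0 (hμ0 k) (hι₁ k hkK) (hι₂ k hkK) hμ3' hprof
      have hG0 : 0 ≤ τ * Y := (sum_nonneg fun δ _ => by have := hμ0 k δ; positivity).trans hG
      have hY0' : 0 ≤ Y := (mul_nonneg_iff_of_pos_left hτ).1 hG0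
      have hVb := towerV_le_fourPiece hτ.le hlam.le hQ'0.le hA'0 (hμ0 k) (hι₁ k hkK) (hι₂ k hkK) hμ3' hprof hx₃
      -- the closing computation, for any born size obeying the step hypothesis with these Chernoff data
      have hclose' : ∀ x : ℝ, (∀ N : ℕ, 2 ≤ N → Φ * towerV D τ (μ k) < 1 →
          x ≤ towerFO D σ (μ k) (3 + (p - 3)) + ∑ n ∈ Icc 2 N, exp 1 * Φ ^ (n - 1) * ψ ^ (3 + (p - 3)) * towerS D τ (μ k) n (3 + (p - 3)) +
            ψ ^ (3 + (p - 3)) * exp 1 * towerV D τ (μ k) * (Φ * towerV D τ (μ k)) ^ N / (1 - Φ * towerV D τ (μ k))) →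
          x ≤ A * lam ^ (3 + (p - 3) - 1) * Q ^ (3 + (p - 3)) := by
        intro x hx
        have hT2 := towerStep_le_of_chernoff (D := D) hΦ hψ hτ.le (hμ0 k) hw
          (towerFO_le_of_four_le hσ hA'0 hlam.le hQ'0.le (hμ0 k) hprof hx₁ (p := 3 + (p - 3)) (by omega) (D := D)) hG hVb hy hθ hx
        refine hT2.trans ?_
        have hinv : (((2 * τ * Q' * lam)⁻¹) ^ (3 + (p - 3) - 1))⁻¹ = (2 * τ * Q' * lam) ^ (3 + (p - 3) - 1) := by rw [inv_pow, inv_inv]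
        rw [hinv]
        have hyq0 : 0 ≤ Φ * (τ * Y) / (1 - Φ * (τ * Y)) := div_nonneg (by positivity) (sub_nonneg.2 hy.le)
        set rr := p - 3 with hrr
        have h4 : (4 * Q') ^ (3 + rr) ≤ (4 * Q') ^ 3 * Q ^ rr := by
          rw [pow_add]; exact mul_le_mul_of_nonneg_left (pow_le_pow_left₀ (by positivity) hu₁ rr) (by positivity)
        have h2 : ψ ^ (3 + rr) * (2 * τ * Q' * lam) ^ (3 + rr - 1) ≤ lam ^ (3 + rr - 1) * ψ * ((2 * τ * ψ * Q') ^ 2 * Q ^ rr) := by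
          have heq : ψ ^ (3 + rr) * (2 * τ * Q' * lam) ^ (3 + rr - 1) = lam ^ (3 + rr - 1) * ψ * ((2 * τ * ψ * Q') ^ 2 * (2 * τ * ψ * Q') ^ rr) := by
            rw [show 3 + rr - 1 = rr + 2 by omega, show 3 + rr = rr + 2 + 1 by omega]
            ring
          rw [heq]
          have hr' : (2 * τ * ψ * Q') ^ rr ≤ Q ^ rr := pow_le_pow_left₀ (by positivity) hu₂ rr
          exact mul_le_mul_of_nonneg_left (mul_le_mul_of_nonneg_left hr' (by positivity)) (by positivity)
        set X₁ := 4 * σ * lam * Q' / (1 - 4 * σ * lam * Q') with hX₁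
        set Z := Φ * (τ * Y) / (1 - Φ * (τ * Y)) with hZ
        calc A' * lam ^ (3 + rr - 1) * (4 * Q') ^ (3 + rr) * X₁ + exp 1 * ψ ^ (3 + rr) * (2 * τ * Q' * lam) ^ (3 + rr - 1) * (τ * Y) * Z
            ≤ A' * lam ^ (3 + rr - 1) * ((4 * Q') ^ 3 * Q ^ rr) * X₁ +
                exp 1 * (lam ^ (3 + rr - 1) * ψ * ((2 * τ * ψ * Q') ^ 2 * Q ^ rr)) * (τ * Y) * Z := by
              have : exp 1 * ψ ^ (3 + rr) * (2 * τ * Q' * lam) ^ (3 + rr - 1) = exp 1 * (ψ ^ (3 + rr) * (2 * τ * Q' * lam) ^ (3 + rr - 1)) := by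
                ring
              rw [this]
              gcongr
          _ = lam ^ (3 + rr - 1) * Q ^ rr * (A' * (4 * Q') ^ 3 * X₁ + exp 1 * ψ * (2 * τ * ψ * Q') ^ 2 * (τ * Y) * Z) := by ring
          _ ≤ lam ^ (3 + rr - 1) * Q ^ rr * (A * Q ^ 3) := mul_le_mul_of_nonneg_left hclose (by positivity)
          _ = A * lam ^ (3 + rr - 1) * Q ^ (3 + rr) := by rw [pow_add]; ring
      have hp3 : p = 3 + (p - 3) := by omega
      have hfin := hclose' (b t (k + 1) p) (fun N hN hguard => by rw [← hp3]; exact hstep t k hkK N hN p hp hpD hguard)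
      rwa [← hp3] at hfin

end Summit.HubbardSuperconductivity.HubbardSuperconductivity.Theorems.EngineV8

end
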